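import Literature.Probability.Percolation.MarkedLoopCoreCensus
import Literature.Probability.Percolation.MarkedLoopTripodBasis
import HarnessLib

/-!
# Certified censuses of the boundary XOR space at a mid-edge («PATTERN-CENSUS»): the finite kit behind the pattern counts `N_p(z)`

Topic `Literature/Probability/Percolation`; generic-`k` layer of the marked-loop (Khristoforov–Smirnov) lineage; the boundary companion of
`MarkedLoopCoreCensus.lean` («CORE-CENSUS»: kernel censuses of the CORES at a face — universe, peeling, pictures from a labelling, counting).
Here the object is the XOR space `TXb D v i s` at the `i`-th side of a face `v` with odd endpoint `s ∈ {v, oppFace v i}` (edge sets of `H_G`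
avoiding `side v i` whose odd touching faces are the corners XOR `s`; Khristoforov–Smirnov's `W_Ω(u_1, …, u_k, z)` split by the half-edge at `z`)
and the quantity to evaluate is the PATTERN COUNT `patternCount D v i p` of `MarkedLoopTripodBasis.lean` — the number of configurations whose
strand from `s` ends at the corner `y_{p.1}` and whose link relation among the corners is `p.2` — i.e. the coefficients of the boundary
link-pattern law `lawLP z` (`MarkedLoopBoundaryLawModule.lean`). To USE the lane's census-certificate criterion for boundary span
(`MarkedLoopBoundarySpanDeterminant.lean`: a square matrix of pattern counts with non-zero determinant ⇒ `BSpan`) on concrete marked domains one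
must evaluate these counts, i.e. enumerate ALL configurations of `TXb D v i s` and read the pattern of each. This file turns such a census into
finitely many `decide`s, in four independent sections:

* `§ Universe` — `subset_erase_of_darts`: an explicit set of darts with an endpoint in `G`, none of them the side `side v i`, spans bonds of
  `hBonds D ∖ {side v i}`; `erase_subset_of_triDir`: conversely that universe lies in any explicit finset containing the six bonds at every site
  of `G`, minus the side; ★ `mem_TXb_of_parity`: membership in the XOR space from a tabulated parity profile (corner faces through a table
  `corner = yc D`).
* `§ Peeling` — ★ `eq_of_agree_TXb` (UNIQUENESS GIVEN THE FREE PART): if a peeling schedule (`schedOK` of «CORE-CENSUS») passes its finite check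
  on a universe `E ⊇ hBonds D ∖ {side v i}`, two configurations of `TXb D v i s` that agree on the free bonds are equal (the parity at the
  scheduled face pins the scheduled side); ★ `exists_eq_table_TXb`: hence every configuration is the tabulated one with the same free part, once
  the table realises every subset of the free bonds.
* `§ Labelling` — ★★ `pattern_iff_of_labelling`: THE PATTERN OF A TABULATED CONFIGURATION READ WITHOUT PATHS: a labelling of the faces constant
  across the bonds of `ξ` (a finite check) such that exactly one corner `y_p` carries the label of `s`, together with the relation `L` = «pairs of
  distinct corners other than `p` with equal labels» (a partial function), forces `(partner, linkRel) = (p, L)` — the partner exists and is unique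
  and the link relation is a perfect matching off the partner by the tree's structure theorems (`existsUnique_inClassX`, `isPattern_linkRel`);
  only label (in)equalities are checked, never connectivity.
* `§ Counting` — ★★ `card_filter_pattern_eq_card` / ★★★ `patternCount_eq_card_add_card`: with complete injective tables of the two half-spaces
  (`s = v` and `s = oppFace v i`) and their patterns, `patternCount D v i p = #{t | patV t = p} + #{t | patO t = p}` — two `decide`s.

The four sections are independent of the number of marks and of the domain; the lane's use is the census of the seven-site hexagon `triBall 1`
with five marks (`2 · 2^6 = 128` configurations per boundary mid-edge), towards `BSpan 5`.

## References
* M. Khristoforov, S. Smirnov, *Percolation and O(1) loop model*, arXiv:2111.15612 (2021), §1.2 (arXiv v1 pp. 2–3: loop configurations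
  `W_Ω(U) = {ξ : ∂ξ = U}` on half-edges, «exactly `2^{#Faces(Ω)}` loop configurations», the link pattern `IP(ξ)` «a union of disjoint paths,
  matching marked points»; p. 2: the law of the link pattern), §2 Definition 3 (p. 4: the class `z ↔ u_j`), eq. (4) and Remark 6 (p. 5).
* B. Bollobás, O. Riordan, *Percolation*, Cambridge University Press (2006), Ch. 7 §7.2.2 (pp. 191–195: marked discrete domains), Lemma 12
  (pp. 206–207: faces and opposite faces).

## Mathlib / tree
Tree: `MarkedLoopCoreCensus.lean` (`schedOK`, `lab_eq_of_xiLinked`, `hBonds_subset_of_triDir`), `MarkedLoopTripodBasis.lean` (`patternCount`,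
`isPattern_linkRel`, `IsPattern.off`, `IsPattern.off₂`, `IsPattern.perfect`), `KhSThreeDisorderNormalisation.lean` (`existsUnique_inClassX`),
`KhSThreeDisorderObservable.lean` (`TXb`, `mem_TXb_iff`, `InClassX`, `ParityIs`), `MarkedLoopHolomorphy.lean` (`linkRel`, `mem_linkRel`),
`MarkedLoopSpace.lean` (`hBonds`, `mem_hBonds`, `yc`, `eq_yc`, `corners`). Mathlib: `Finset.card_bij`, `decide`.
-/

open Finset

namespace Literature.Probability.Percolation.MarkedLoops

open Literature.Probability.Percolation Literature.Probability.LatticeModels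
open Literature.Probability.Percolation.FivePoint (xiDeg XiLinked side)
open TriMarkedDomain

variable {nm : ℕ} {D : TriMarkedDomain nm}

/-! ### The bond universe of the XOR space at a side -/
section Universe

variable (D) in
/-- an explicit set of darts, each with an endpoint in `G` and none of them the side `side v i`, spans bonds of `hBonds D ∖ {side v i}`.
[cite: KhristoforovSmirnov2021, §1.2 (arXiv v1 pp. 2–3: the half-edges of `Ω`)] -/
theorem subset_erase_of_darts {v : HexVertex} {i : Fin 3} {E : Finset (Site 2 × Site 2)}
    (h : ∀ d ∈ E, triGraph.Adj d.1 d.2 ∧ (d.1 ∈ D.verts ∨ d.2 ∈ D.verts) ∧ s(d.1, d.2) ≠ side v i)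
    {ξ : Finset (Sym2 (Site 2))} (hξ : ∀ b ∈ ξ, ∃ d ∈ E, b = s(d.1, d.2)) : ξ ⊆ (hBonds D).erase (side v i) := by
  intro b hb
  obtain ⟨d, hd, rfl⟩ := hξ b hb
  obtain ⟨hadj, hG, hside⟩ := h d hd
  exact Finset.mem_erase.2 ⟨hside, mem_hBonds D hadj hG⟩

variable (D) in
/-- `hBonds D ∖ {side v i}` lies in the explicit universe: the bonds at the sites of `G` other than the side.
[cite: KhristoforovSmirnov2021, §1.2 (arXiv v1 pp. 2–3: the half-edges of `Ω`)] -/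
theorem erase_subset_of_triDir (v : HexVertex) (i : Fin 3) {HB : Finset (Sym2 (Site 2))} (h : ∀ u ∈ D.verts, ∀ j : Fin 6, s(u, u + triDir j) ∈ HB) :
    (hBonds D).erase (side v i) ⊆ HB.erase (side v i) := by
  intro b hb
  obtain ⟨hne, hbh⟩ := Finset.mem_erase.1 hb
  exact Finset.mem_erase.2 ⟨hne, hBonds_subset_of_triDir D h hbh⟩

/-- a configuration of the XOR space lies in `H_G`. [cite: KhristoforovSmirnov2021, §1.2 (arXiv v1 pp. 2–3)] -/
theorem subset_hBonds_of_mem_TXb {v : HexVertex} {i : Fin 3} {s : HexVertex} {ξ : Finset (Sym2 (Site 2))} (hξ : ξ ∈ TXb D v i s) :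
    ξ ⊆ hBonds D := by
  rw [mem_TXb_iff] at hξ
  exact fun b hb => Finset.mem_of_mem_erase (hξ.1 hb)

/-- ★ membership in the XOR space from a tabulated parity profile (`% 2` form, as `decide` produces it) and a table of the corner faces: the odd
touching faces are the corners XOR `s`. [cite: KhristoforovSmirnov2021, §1.2 (arXiv v1 pp. 2–3: `W_Ω(U) = {ξ : ∂ξ = U}`)] -/
theorem mem_TXb_of_parity {v : HexVertex} {i : Fin 3} {s : HexVertex} {ξ : Finset (Sym2 (Site 2))} (hξ : ξ ⊆ (hBonds D).erase (side v i))
    (corner : Fin nm → HexVertex) (hc : ∀ j, yc D j = corner j)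
    (hpar : ∀ F ∈ triFacesTouching D.verts, (xiDeg ξ F % 2 = 1 ↔ F ∈ symmDiff ((Finset.univ : Finset (Fin nm)).image corner) {s})) :
    ξ ∈ TXb D v i s := by
  classical
  have hcorners : corners D = (Finset.univ : Finset (Fin nm)).image corner := by
    unfold corners
    exact Finset.image_congr fun j _ => hc j
  rw [mem_TXb_iff]
  refine ⟨hξ, fun F hF => ?_⟩
  rw [Nat.odd_iff, hcorners]
  exact hpar F hF

end Universe

/-! ### Peeling: a configuration is determined by its free bonds -/
section Peeling

/-- the side count modulo two is a function of the three side memberships. [folklore] -/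
private theorem xiDeg_eq_card' (ζ : Finset (Sym2 (Site 2))) (F : HexVertex) :
    xiDeg ζ F = #((Finset.univ : Finset (Fin 3)).filter fun j => side F j ∈ ζ) := by
  unfold xiDeg side
  rfl

/-- parity bookkeeping on three Booleans: two side-indicator functions that agree off `j` and have side counts of the same parity agree at `j`.
[folklore] -/
private theorem agree_third_bool' : ∀ (j : Fin 3) (f g : Fin 3 → Bool), (∀ j', j' ≠ j → f j' = g j') →
    (Odd #((Finset.univ : Finset (Fin 3)).filter fun j' => f j' = true) ↔
      Odd #((Finset.univ : Finset (Fin 3)).filter fun j' => g j' = true)) → f j = g j := by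
  decide

/-- the same for decidable predicates. [folklore] -/
private theorem agree_third' {p q : Fin 3 → Prop} [DecidablePred p] [DecidablePred q] (j : Fin 3) (hoff : ∀ j', j' ≠ j → (p j' ↔ q j'))
    (hpar : Odd #((Finset.univ : Finset (Fin 3)).filter p) ↔ Odd #((Finset.univ : Finset (Fin 3)).filter q)) : p j ↔ q j := by
  have hp : (Finset.univ : Finset (Fin 3)).filter p = (Finset.univ : Finset (Fin 3)).filter fun j' => decide (p j') = true :=
    Finset.filter_congr fun j' _ => by rw [decide_eq_true_iff]
  have hq : (Finset.univ : Finset (Fin 3)).filter q = (Finset.univ : Finset (Fin 3)).filter fun j' => decide (q j') = true :=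
    Finset.filter_congr fun j' _ => by rw [decide_eq_true_iff]
  rw [hp, hq] at hpar
  have e := agree_third_bool' j (fun j' => decide (p j')) (fun j' => decide (q j'))
    (fun j' hj' => by rw [Bool.decide_congr (hoff j' hj')]) hpar
  simpa using e

/-- two edge sets inside a universe `E` with the same side parities at every touching face and agreeing on the free bonds of a passing peeling
schedule are equal. [cite: KhristoforovSmirnov2021, §1.2 (arXiv v1 pp. 2–3: `∂ξ = U`; p. 3: «exactly `2^{#Faces(Ω)}` loop configurations»)] -/
theorem eq_of_agree_of_parity {E Free : Finset (Sym2 (Site 2))} {sched : List (HexVertex × Fin 3)}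
    (hok : schedOK (triFacesTouching D.verts) E sched Free = true) {ζ ζ' : Finset (Sym2 (Site 2))} (hζE : ζ ⊆ E) (hζ'E : ζ' ⊆ E)
    (hparity : ∀ F ∈ triFacesTouching D.verts, (Odd (xiDeg ζ F) ↔ Odd (xiDeg ζ' F))) (hagree : ∀ e ∈ Free, e ∈ ζ ↔ e ∈ ζ') : ζ = ζ' := by
  classical
  have main : ∀ (sc : List (HexVertex × Fin 3)) (known : Finset (Sym2 (Site 2))),
      schedOK (triFacesTouching D.verts) E sc known = true → (∀ e ∈ known, e ∈ ζ ↔ e ∈ ζ') → ∀ e ∈ E, e ∈ ζ ↔ e ∈ ζ' := by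
    intro sc
    induction sc with
    | nil =>
      intro known hok hknown e he
      have hsub : E ⊆ known := by simpa [schedOK] using hok
      exact hknown e (hsub he)
    | cons Fj rest ih =>
      obtain ⟨F, j⟩ := Fj
      intro known hok hknown
      simp only [schedOK, Bool.and_eq_true, decide_eq_true_eq] at hok
      obtain ⟨⟨hF, hother⟩, hrest⟩ := hok
      refine ih _ hrest fun e he => ?_
      rcases Finset.mem_insert.1 he with rfl | he
      · have hoff : ∀ j', j' ≠ j → (side F j' ∈ ζ ↔ side F j' ∈ ζ') := by
          intro j' hj'
          rcases hother j' hj' with h | h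
          · exact hknown _ h
          · exact ⟨fun hm => absurd (hζE hm) h, fun hm => absurd (hζ'E hm) h⟩
        have hpar := hparity F hF
        rw [xiDeg_eq_card', xiDeg_eq_card'] at hpar
        exact agree_third' (p := fun j => side F j ∈ ζ) (q := fun j => side F j ∈ ζ') j hoff hpar
      · exact hknown e he
  have hall := main sched Free hok hagree
  ext e
  by_cases he : e ∈ E
  · exact hall e he
  · exact ⟨fun hm => absurd (hζE hm) he, fun hm => absurd (hζ'E hm) he⟩

/-- ★ **UNIQUENESS OF A CONFIGURATION GIVEN ITS FREE PART**: if the peeling check passes on a universe containing `hBonds D ∖ {side v i}`, two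
configurations of the XOR space `TXb D v i s` that agree on the free bonds are equal.
[cite: KhristoforovSmirnov2021, §1.2 (arXiv v1 pp. 2–3: `W_Ω(U) = {ξ : ∂ξ = U}`; p. 3: «exactly `2^{#Faces(Ω)}` loop configurations»)] -/
theorem eq_of_agree_TXb {v : HexVertex} {i : Fin 3} {s : HexVertex} {E Free : Finset (Sym2 (Site 2))} {sched : List (HexVertex × Fin 3)}
    (hE : (hBonds D).erase (side v i) ⊆ E) (hok : schedOK (triFacesTouching D.verts) E sched Free = true)
    {ξ ξ' : Finset (Sym2 (Site 2))} (hξ : ξ ∈ TXb D v i s) (hξ' : ξ' ∈ TXb D v i s) (hagree : ∀ e ∈ Free, e ∈ ξ ↔ e ∈ ξ') : ξ = ξ' := by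
  rw [mem_TXb_iff] at hξ hξ'
  exact eq_of_agree_of_parity hok (fun b hb => hE (hξ.1 hb)) (fun b hb => hE (hξ'.1 hb))
    (fun F hF => (hξ.2 F hF).trans (hξ'.2 F hF).symm) hagree

/-- ★ **EVERY CONFIGURATION IS IN THE TABLE**: if, moreover, a table `cfg : ι → _` of configurations of `TXb D v i s` realises every subset of the
free bonds, then every configuration equals a tabulated one. [cite: KhristoforovSmirnov2021, §1.2 (arXiv v1 p. 3: «exactly `2^{#Faces(Ω)}` loop
configurations»)] -/
theorem exists_eq_table_TXb {v : HexVertex} {i : Fin 3} {s : HexVertex} {E Free : Finset (Sym2 (Site 2))} {sched : List (HexVertex × Fin 3)}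
    (hE : (hBonds D).erase (side v i) ⊆ E) (hok : schedOK (triFacesTouching D.verts) E sched Free = true)
    {ι : Type*} (cfg : ι → Finset (Sym2 (Site 2))) (hcfg : ∀ t, cfg t ∈ TXb D v i s)
    (hsurj : ∀ T ∈ Free.powerset, ∃ t, ∀ e ∈ Free, e ∈ cfg t ↔ e ∈ T)
    {ξ : Finset (Sym2 (Site 2))} (hξ : ξ ∈ TXb D v i s) : ∃ t, ξ = cfg t := by
  classical
  obtain ⟨t, ht⟩ := hsurj (Free.filter (· ∈ ξ)) (Finset.mem_powerset.2 (Finset.filter_subset _ _))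
  refine ⟨t, eq_of_agree_TXb hE hok hξ (hcfg t) fun e he => ?_⟩
  rw [ht e he, Finset.mem_filter]
  exact ⟨fun h => ⟨he, h⟩, fun h => h.2⟩

end Peeling

/-! ### The pattern from a labelling of the faces -/
section Labelling

/-- ★★ **THE PATTERN FROM A LABELLING**: at the `i`-th side of a face `v` with three `H_G`-sides, odd endpoint `s ∈ {v, oppFace v i}` not a
corner, a configuration `ξ` of the XOR space, a labelling `lab` of the faces constant across the bonds of `ξ`, a corner index `p` such that no
corner other than `y_p` carries the label of `s`, and a relation `L` containing every pair of distinct corners other than `p` with equal labels,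
avoiding `p` in the first entry, and functional: then the strand from `s` ends at `y_p` and the link relation of `ξ` is `L` — and at no other
(partner, relation). No path is ever exhibited: the partner exists and is unique (`existsUnique_inClassX`) and the link relation is a perfect
matching of the other corners (`isPattern_linkRel`). (Corner faces through a table `corner = yc D`.)
[cite: KhristoforovSmirnov2021, §1.2 (arXiv v1 p. 2: «IP(ξ) is a union of disjoint paths, matching marked points»); §2 Definition 3 (p. 4: the class `z ↔ u_j`)] -/
theorem pattern_iff_of_labelling {v : HexVertex} (hv : AllSides D v) {i : Fin 3} {s : HexVertex}
    (hs : s ∈ ({v, oppFace v i} : Finset HexVertex)) (hsc : s ∉ corners D) {ξ : Finset (Sym2 (Site 2))} (hξ : ξ ∈ TXb D v i s)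
    (corner : Fin nm → HexVertex) (hc : ∀ j, yc D j = corner j) {L' : Type*} (lab : HexVertex → L')
    (hclosed : ∀ F ∈ triFacesTouching D.verts, ∀ j : Fin 3, side F j ∈ ξ → lab (oppFace F j) = lab F)
    (p : Fin nm) (huniq : ∀ c : Fin nm, lab (corner c) = lab s → c = p)
    (L : Finset (Fin nm × Fin nm)) (hL1 : ∀ cd ∈ L, cd.1 ≠ p)
    (hL2 : ∀ c d : Fin nm, c ≠ d → c ≠ p → d ≠ p → lab (corner c) = lab (corner d) → (c, d) ∈ L)
    (hL3 : ∀ c d d' : Fin nm, (c, d) ∈ L → (c, d') ∈ L → d = d') (j : Fin nm) (M : Finset (Fin nm × Fin nm)) :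
    (InClassX D (faceVertex v (i + 1)) (faceVertex v (i + 2)) s j ξ ∧ linkRel D ξ = M) ↔ (j = p ∧ M = L) := by
  classical
  have hξh : ξ ⊆ hBonds D := subset_hBonds_of_mem_TXb hξ
  have hlink : ∀ {Y Y'}, XiLinked ξ Y Y' → lab Y = lab Y' := fun h => lab_eq_of_xiLinked hξh lab hclosed h
  -- the partner is `p`
  obtain ⟨j₀, hj₀, huj⟩ := existsUnique_inClassX D hv i hs hξ
  have hj₀p : j₀ = p := by
    obtain ⟨-, Y, hY, hl⟩ := hj₀
    have hYc : Y = corner j₀ := (eq_yc D hY).trans (hc j₀)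
    refine huniq j₀ ?_
    rw [← hYc]
    exact (hlink hl).symm
  -- the link relation is `L`
  have hpat : IsPattern j₀ (linkRel D ξ) := isPattern_linkRel hv hs hsc hξ hj₀
  have hsub : linkRel D ξ ⊆ L := by
    rintro ⟨c, d⟩ hcd
    obtain ⟨hne, hl⟩ := mem_linkRel.1 hcd
    have hcp : c ≠ p := hj₀p ▸ hpat.off c d hcd
    have hdp : d ≠ p := hj₀p ▸ hpat.off₂ hcd
    refine hL2 c d hne hcp hdp ?_
    have := hlink hl
    rwa [hc, hc] at this
  have hrel : linkRel D ξ = L := by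
    refine Finset.Subset.antisymm hsub ?_
    rintro ⟨c, d⟩ hcd
    have hcj : c ≠ j₀ := hj₀p.symm ▸ hL1 _ hcd
    obtain ⟨d', hd', -⟩ := hpat.perfect c hcj
    have e : d' = d := hL3 c d' d (hsub hd') hcd
    rw [← e]; exact hd'
  constructor
  · rintro ⟨hj, hM⟩
    exact ⟨(huj j hj).trans hj₀p, hM.symm.trans hrel⟩
  · rintro ⟨rfl, rfl⟩
    exact ⟨hj₀p ▸ hj₀, hrel⟩

end Labelling

/-! ### Counting from complete tables of the two half-spaces -/
section Counting

open Classical in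
/-- ★★ **THE CLASS COUNTS OF ONE HALF FROM A CENSUS**: with an injective table `cfg : ι → _` of ALL the configurations of `TXb D v i s` and their
patterns `pat`, the number of configurations with (partner, link relation) `q` is `#{t | pat t = q}`.
[cite: KhristoforovSmirnov2021, §1.2 (arXiv v1 p. 2: the law of the link pattern); §2 Definition 3 (p. 4)] -/
theorem card_filter_pattern_eq_card {v : HexVertex} {i : Fin 3} {s : HexVertex} {ι : Type*} [Fintype ι] (cfg : ι → Finset (Sym2 (Site 2)))
    (hinj : Function.Injective cfg) (hcfg : ∀ t, cfg t ∈ TXb D v i s) (hcomplete : ∀ ξ ∈ TXb D v i s, ∃ t, ξ = cfg t)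
    (pat : ι → Fin nm × Finset (Fin nm × Fin nm))
    (hpat : ∀ t j M, (InClassX D (faceVertex v (i + 1)) (faceVertex v (i + 2)) s j (cfg t) ∧ linkRel D (cfg t) = M) ↔ pat t = (j, M))
    (q : Fin nm × Finset (Fin nm × Fin nm)) :
    #((TXb D v i s).filter fun ξ => InClassX D (faceVertex v (i + 1)) (faceVertex v (i + 2)) s q.1 ξ ∧ linkRel D ξ = q.2) =
      #((Finset.univ : Finset ι).filter fun t => pat t = q) := by
  symm
  refine Finset.card_bij (fun t _ => cfg t) (fun t ht => ?_) (fun t ht t' ht' h => hinj h) (fun ξ hξ => ?_)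
  · rw [Finset.mem_filter] at ht ⊢
    exact ⟨hcfg t, (hpat t q.1 q.2).2 ht.2⟩
  · rw [Finset.mem_filter] at hξ
    obtain ⟨hmem, hq⟩ := hξ
    obtain ⟨t, rfl⟩ := hcomplete ξ hmem
    exact ⟨t, Finset.mem_filter.2 ⟨Finset.mem_univ _, (hpat t q.1 q.2).1 hq⟩, rfl⟩

open Classical in
/-- ★★★ **THE PATTERN COUNTS FROM A CENSUS OF BOTH HALVES**: with complete injective tables of the XOR spaces at the two half-edges (`s = v` and
`s = oppFace v i`) and their patterns, `N_p(z) = #{t | patV t = p} + #{t | patO t = p}` — two `decide`s.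
[cite: KhristoforovSmirnov2021, §1.2 (arXiv v1 p. 2: «the law of the link pattern»); §2 Definition 3 (p. 4); eq. (4) and Remark 6 (p. 5)] -/
theorem patternCount_eq_card_add_card {v : HexVertex} {i : Fin 3} {ι κ : Type*} [Fintype ι] [Fintype κ]
    (cfgV : ι → Finset (Sym2 (Site 2))) (hinjV : Function.Injective cfgV) (hcfgV : ∀ t, cfgV t ∈ TXb D v i v)
    (hcompleteV : ∀ ξ ∈ TXb D v i v, ∃ t, ξ = cfgV t) (patV : ι → Fin nm × Finset (Fin nm × Fin nm))
    (hpatV : ∀ t j M, (InClassX D (faceVertex v (i + 1)) (faceVertex v (i + 2)) v j (cfgV t) ∧ linkRel D (cfgV t) = M) ↔ patV t = (j, M))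
    (cfgO : κ → Finset (Sym2 (Site 2))) (hinjO : Function.Injective cfgO) (hcfgO : ∀ t, cfgO t ∈ TXb D v i (oppFace v i))
    (hcompleteO : ∀ ξ ∈ TXb D v i (oppFace v i), ∃ t, ξ = cfgO t) (patO : κ → Fin nm × Finset (Fin nm × Fin nm))
    (hpatO : ∀ t j M, (InClassX D (faceVertex v (i + 1)) (faceVertex v (i + 2)) (oppFace v i) j (cfgO t) ∧ linkRel D (cfgO t) = M) ↔
      patO t = (j, M))
    (p : Pat nm) :
    patternCount D v i p = #((Finset.univ : Finset ι).filter fun t => patV t = p.1) + #((Finset.univ : Finset κ).filter fun t => patO t = p.1) := by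
  unfold patternCount
  rw [card_filter_pattern_eq_card cfgV hinjV hcfgV hcompleteV patV hpatV p.1,
    card_filter_pattern_eq_card cfgO hinjO hcfgO hcompleteO patO hpatO p.1]

end Counting

end Literature.Probability.Percolation.MarkedLoops
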